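/-
Origin: expansion seat `planner-pub-hodgecm-carver-0`, handover 2026-08-18T03:27:49Z (synced 03:34:05Z) (`HOME/pub-hodgecm-carver/lean/Carver/PerL34/Wedge.lean`, md5 197a4094, 66 lines);
landed by the gen-5 packager in gate run 18 as `HodgeCM/PerL34/Wedge.lean` (verbatim).
-/
/-
Origin: HOME/pub-hodgecm-carver/lean/HodgeCM/PerL34/Wedge.lean — session planner-pub-hodgecm-carver-0 (unit
pub-hodgecm-carver, THE CARVER).  Intended final place: `HodgeCM/PerL34/Wedge.lean`.
DAG node (HOME/LEMMAS.md §1): N33 (Proposition 4.3 `prop:S12`, tex ll. 639–642) with proof steps N33a–N33e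
(ll. 644–681).  Nothing is asserted.
-/
import Summits.HodgeConjecture.HodgeCM.Automorphic.ThetaFacts

set_option autoImplicit false

/-!
# PerL v5 §4.3 — non-vanishing of a wedge (DAG node N33 and sub-steps)

* **N33** (Prop 4.3, ll. 639–642): "There are allowed data of types `\Psi_1,\Psi_2` and holomorphic `1`-forms
  `u_j\in(\pi_j\otimes\tau)^{K_\infty}` with `u_1\wedge u_2\ne0`. In particular `S_{12}\ne0`."  Typed ON FORMS at
  some torsion-free level (= model fact `Open_thetaWedge`; the package field `ThetaRealisation.lineField` is its
  `L²`-function form, obtained from it by Hodge–Riemann in `Proofs/RealisationConstruction`).  Review R1's FIRST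
  ERROR (v1: spans over ALL `π`; repaired v2: spans over the FIXED `(W_i, μ_i)`) lives in step N33d.
* **N33a–N33d** (ll. 644–667): projection `Θ_i(χ')[𝔭₊] ≠ 0`, `u_f` holomorphic + equivariance, the spans `𝒰_i`,
  membership of wedges in `S₁₂` for the fixed lines — NOT separately typeable today (automorphic-forms vocabulary,
  LEMMAS.md §3 D2); N33d's interface form `lineField ∧ gen12 ⇒ S₁₂ ≠ ⊥` is PROVED (`StubTree.prop43`).
* **N33e** (ll. 667–681, the line-field contradiction): its finite-dimensional CORE is typed below and is
  Mathlib-provable now: `N33e_core_noInvariantLine` (no line of `ℂ²` is invariant under all of `U(2)`; PerL: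
  "`\mathrm{SU}(2)` is transitive on the lines of `\C^2`: contradiction") and `N33e_core_minors` (a family of
  vectors pairwise proportional to a fixed non-zero vector spans a space of rank ≤ 1; PerL ll. 668–671).  The
  analytic shell (dense `Δ`, continuity of `ℓ` on `Ω`, real approximation [San Cor 3.5(iii)] / [PR Thm 7.7]) needs
  D6 and is not typed.
-/

noncomputable section

namespace HodgeCM
namespace PerL34

variable {U : Universe} (T : U.ThetaModel)

/-- **N33** (PerL v5 Proposition 4.3 `prop:S12`, tex ll. 639–642): "There are allowed data of types
`\Psi_1,\Psi_2` and holomorphic `1`-forms `u_j\in(\pi_j\otimes\tau)^{K_\infty}` with `u_1\wedge u_2\ne0`. In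
particular `S_{12}\ne0`."  = `Open_thetaWedge` (forms `ω₁ ∈ Theta 0 Γ`, `ω₂ ∈ Theta 1 Γ` with `ω₁ ∪ ω₂ ≠ 0` at
some level, in every good context).  INTERNAL — no print source ("the heart"). -/
def N33_wedge : Prop := T.Open_thetaWedge

/-- (Ported verbatim from the HodgeCMPerL package; no docstring in the source.) -/
theorem N33_iff : N33_wedge T ↔ T.Open_thetaWedge := Iff.rfl

/-- **N33e core (i)** (PerL v5 Prop 4.3 proof, tex ll. 677–680): "the line `\ell_{x_0}\subset T^*_{x_0}\mathbb
B^2\cong\C^2` is `K_{x_0}`-invariant. But `K_{x_0}` acts on `T^*_{x_0}\mathbb B^2` through the standard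
representation of `\U(2)` twisted by a character, and `\mathrm{SU}(2)` is transitive on the lines of `\C^2`:
contradiction."  Typed: no one-dimensional subspace of `ℂ²` is mapped into itself by every unitary matrix.
Mathlib-provable now. -/
def N33e_core_noInvariantLine : Prop :=
  ∀ ℓ : Submodule ℂ (Fin 2 → ℂ), Module.finrank ℂ ℓ = 1 →
    ∃ g : Matrix.unitaryGroup (Fin 2) ℂ,
      ¬ Submodule.map (Matrix.toLin' (g : Matrix (Fin 2) (Fin 2) ℂ)) ℓ ≤ ℓ

/-- **N33e core (ii)** (PerL v5 Prop 4.3 proof, tex ll. 668–671): "Fix `0\ne u_1`; on the dense open set where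
`u_1\ne0` every `u_2\in\mathcal U_2` is pointwise proportional to `u_1`, so all `2\times2` minors `u_2\wedge u_2'`
… vanish there … the evaluation images `\ell_x:=\mathrm{ev}_x(\mathcal U_2)` are lines".  Typed pointwise: vectors
of `ℂ²` all proportional to one non-zero vector span a subspace of rank ≤ 1.  Mathlib-provable now. -/
def N33e_core_minors : Prop :=
  ∀ (u : Fin 2 → ℂ), u ≠ 0 → ∀ S : Set (Fin 2 → ℂ), (∀ v ∈ S, ∃ a : ℂ, v = a • u) →
    Module.finrank ℂ (Submodule.span ℂ S) ≤ 1

end PerL34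
end HodgeCM

end
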